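import Summits.CriticalPhenomena.PercolationContinuityZ3.Theorems.PercNearOneGluingNoHeavyRsw3SetToSetArmVisitsIIC
import Summits.CriticalPhenomena.PercolationContinuityZ3.Theorems.PercAnnulusCrossingIICPlanarKesten
import HarnessLib

/-!
# RSW3 lane (P2, gen 18): the PLANAR instances are UNCONDITIONAL — on `ℤ²` at `p_c(ℤ²) = 1/2`: Kesten's `τ(0,x) ≍ π(‖x‖_∞)²` for every
# `x ≠ 0` (`η = 2/ρ`), and Kesten's IIC visits and avoids every mesoscopic ball

builds on p205010 (kernel theorem, internal audit signed; external expert review pending) — the IIC-existence corollary goes through p1's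
planar files (`Crossing.exists_setToSetQuasiMultAspectAt_two_of_criticalProbI_le`, RSW) and `kestenIICExistsAt_criticalProbI_of_setToSetQuasiMultAspectAt`
(which cites `θ(p_c) = 0` in all dimensions; on `ℤ²` this is Harris–Kesten, but the tree's proof term is the general one).

Cell `prim-rsw3`, prover seat `prim-rsw3-p2` (gen 18), memo `run/shared/lean/prim/rsw3/P2-RSWLITE.md` §25.
Support file (`--supports stmt-CriticalPhenomena-4575`); no definitions, no named facts, no sorries.

(A2)□ holds on `ℤ²` at aspect `(9, 77)` for every `p ≥ p_c(ℤ²)` (p1 gen 6, from RSW).  Hence the gen-17/18 consequences of (A2)□ are theorems of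
planar critical percolation: `exists_tau_two_sided_Z2` — **`c·π_{1/2}(‖x‖_∞)² ≤ τ_{1/2}(0,x) ≤ C·π_{1/2}(‖x‖_∞)²` for every `x ≠ 0`** (Kesten 1987's
relation between the two-point function and the one-arm probability, `η = 2/ρ` — numerically `5/24 = 2·(5/48)`), its finite-volume form, and
**Kesten's planar IIC meets every ball `Λ_t(m)` with `m ≤ ‖t‖_∞ ≤ Cm` with probability `≥ c(C)` and has an arm to `∂Λ(R)` avoiding it with
probability `≥ c(C)`** (`exists_iicMeasure_visits_avoids_Z2`) — folklore consequences of RSW, here obtained through the `ℤ^d` route.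

References: H. Kesten, Comm. Math. Phys. 109 (1987) 109–156, Thm. 1/(1.13) [Kesten1987]; H. Kesten, Probab. Theory Relat. Fields 73 (1986)
369–394, Thm. (3) [Kesten1986]; G. Grimmett, *Percolation* (1999), §9.1, §11.7 [GrimmettPercolation1999]. [folklore]
-/

noncomputable section

namespace Summit.CriticalPhenomena.PercolationContinuityZ3.Theorems

namespace Rsw3

open MeasureTheory Filter Topology Literature.Probability.LatticeModels Literature.Probability.Percolation
open SurfaceTension Crossing SimpleGraph

/-- **Kesten 1987 on `ℤ²`, unconditionally: `τ_{p_c}(0,x) ≍ π_{p_c}(‖x‖_∞)²` for every `x ≠ 0`** (bond percolation, `p_c(ℤ²) = 1/2`; `i` any coordinate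
of maximal modulus): `∃ 0 < c ≤ C, c·π(|x_i|)² ≤ τ(0,x) ≤ C·π(|x_i|)²`. [cite: Kesten1987, Thm. 1] -/
theorem exists_tau_two_sided_Z2 :
    ∃ c C : ℝ, 0 < c ∧ 0 < C ∧ ∀ (x : Site 2) (i : Fin 2), (∀ j, (x j).natAbs ≤ (x i).natAbs) → 1 ≤ (x i).natAbs →
      c * oneArmProb 2 (criticalProbI 2) (x i).natAbs ^ 2 ≤ tau 2 (criticalProbI 2) 0 x ∧
        tau 2 (criticalProbI 2) 0 x ≤ C * oneArmProb 2 (criticalProbI 2) (x i).natAbs ^ 2 := by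
  obtain ⟨ϰ, hϰ, hA2⟩ := exists_setToSetQuasiMultAspectAt_two_of_criticalProbI_le
  exact exists_tau_two_sided_of_setToSetQuasiMultAspectAt (d := 2) le_rfl (hA2 _ le_rfl) hϰ (by norm_num) (by norm_num)

/-- **Finite-volume form on `ℤ²`, unconditionally**: `∃ c > 0`, for every `x` with `‖x‖_∞ ≥ 79` (`i` maximal):
`c·π_{p_c}(‖x‖_∞)² ≤ P_{p_c}[x ↔ 0 in Λ(4‖x‖_∞)]`. [cite: Kesten1987, Thm. 1] -/
theorem exists_mul_sq_oneArmProb_le_real_openCrossing_Z2 :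
    ∃ c : ℝ, 0 < c ∧ ∀ (x : Site 2) (i : Fin 2), (∀ j, (x j).natAbs ≤ (x i).natAbs) → 79 ≤ (x i).natAbs →
      c * oneArmProb 2 (criticalProbI 2) (x i).natAbs ^ 2 ≤ (bondPercolation (zdGraph 2) (criticalProbI 2)).real
        (openCrossing (↑(box 2 (4 * (x i).natAbs)) : Set (Site 2)) ↑({x} : Finset (Site 2)) ↑({(0 : Site 2)} : Finset (Site 2))) := by
  obtain ⟨ϰ, hϰ, hA2⟩ := exists_setToSetQuasiMultAspectAt_two_of_criticalProbI_le
  exact exists_mul_sq_oneArmProb_le_real_openCrossing_of_setToSetQuasiMultAspectAt (d := 2) le_rfl (hA2 _ le_rfl) hϰ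
    (by norm_num) (by norm_num)

/-- **Pre-limit visits on `ℤ²`, unconditionally**: for every `C` there is `c > 0` with
`c·π_{p_c}(n) ≤ P_{p_c}[{0 ↔ ∂Λ(n)} ∩ {{0} ↔ Λ_t(m) in Λ(‖t‖_∞)}]` for all `m ≥ 624`, `m ≤ ‖t‖_∞ ≤ Cm`, `n ≥ 77(‖t‖_∞+1)+1`.
[cite: Kesten1986, Thm. 3] -/
theorem exists_mul_oneArmProb_le_real_visits_Z2 (C : ℕ) :
    ∃ c : ℝ, 0 < c ∧ ∀ (m : ℕ) (t : Site 2) (i : Fin 2) (n : ℕ), 8 * (77 + 1) ≤ m →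
      (∀ j, (t j).natAbs ≤ (t i).natAbs) → m ≤ (t i).natAbs → (t i).natAbs ≤ C * m →
      77 * ((t i).natAbs + 1) + 1 ≤ n →
        c * oneArmProb 2 (criticalProbI 2) n ≤ (bondPercolation (zdGraph 2) (criticalProbI 2)).real
          (siteToBoundary 2 n ∩
            openCrossing (↑(box 2 (t i).natAbs) : Set (Site 2)) ↑({(0 : Site 2)} : Finset (Site 2)) ↑(GM.ball t m)) := by
  obtain ⟨ϰ, hϰ, hA2⟩ := exists_setToSetQuasiMultAspectAt_two_of_criticalProbI_le
  exact exists_mul_oneArmProb_le_real_visits_local_of_setToSetQuasiMultAspectAt (d := 2) le_rfl (hA2 _ le_rfl) hϰ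
    (by norm_num) (by norm_num) C

/-- **Kesten's planar IIC visits and avoids every mesoscopic ball, unconditionally**: there is an IIC probability measure `ν` on `ℤ²` at
`p_c = 1/2` (Kesten 1986) and, for every `C`, a `c > 0` with `c ≤ ν({0} ↔ Λ_t(m) in Λ(‖t‖_∞))` (`624 ≤ m ≤ ‖t‖_∞ ≤ Cm`) and
`c ≤ ν({0} ↔ ∂ⁱⁿΛ(R) in Λ(R) ∖ Λ_t(m))` (`2m ≤ ‖t‖_∞ ≤ Cm`, `R ≥ 77(‖t‖_∞+m+1)+1`). [cite: Kesten1986, Thm. 3] -/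
theorem exists_iicMeasure_visits_avoids_Z2 (C : ℕ) :
    ∃ ν : Measure (BondConfig (Site 2)), IsProbabilityMeasure ν ∧
      (∀ (F : Finset (Sym2 (Site 2))) (E : Set (BondConfig (Site 2))), MeasurableSet E → DeterminedBy E ↑F →
        Tendsto (fun n : ℕ => (bondPercolation (zdGraph 2) (criticalProbI 2)).real (E ∩ siteToBoundary 2 n) /
          oneArmProb 2 (criticalProbI 2) n) atTop (𝓝 (ν.real E))) ∧
      ∃ c : ℝ, 0 < c ∧
        (∀ (m : ℕ) (t : Site 2) (i : Fin 2), 8 * (77 + 1) ≤ m → (∀ j, (t j).natAbs ≤ (t i).natAbs) → m ≤ (t i).natAbs →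
          (t i).natAbs ≤ C * m →
            c ≤ ν.real (openCrossing (↑(box 2 (t i).natAbs) : Set (Site 2)) ↑({(0 : Site 2)} : Finset (Site 2)) ↑(GM.ball t m))) ∧
        (∀ (m : ℕ) (t : Site 2) (i : Fin 2) (R : ℕ), 8 * (77 + 1) ≤ m → (∀ j, (t j).natAbs ≤ (t i).natAbs) →
          2 * m ≤ (t i).natAbs → (t i).natAbs ≤ C * m → 77 * ((t i).natAbs + m + 1) + 1 ≤ R →
            c ≤ ν.real (openCrossing (↑(box 2 R \ GM.ball t m) : Set (Site 2)) ↑({(0 : Site 2)} : Finset (Site 2))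
              ↑(innerBoundary (zdGraph 2) (box 2 R)))) := by
  obtain ⟨ϰ, hϰ, hA2⟩ := exists_setToSetQuasiMultAspectAt_two_of_criticalProbI_le
  exact exists_iicMeasure_visits_avoids_of_setToSetQuasiMultAspectAt (d := 2) le_rfl (hA2 _ le_rfl) hϰ (by norm_num) (by norm_num) C

end Rsw3

end Summit.CriticalPhenomena.PercolationContinuityZ3.Theorems
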